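import Summits.Parity.BatemanHorn.Theorems.SoloInformedWindowRootFourierLocated
import Summits.Parity.BatemanHorn.Theorems.SoloInformedRootPairCorrelation
import Literature.Analysis.Fourier.ErdosTuranInequality
import HarnessLib

/-!
# Erdős–Turán on one block of located moduli (block lemma for window equidistribution)

[this work]  Let `g ∈ ℤ[X]` and write (tree objects)

* `W_g(x; y₁, y₂) = polyWindowRootCount g x y₁ y₂ = #{(n, e) : n ≤ x, e ∣ g(n), y₁ < e ≤ y₂}`,
* `Heur_g(x; y₁, y₂) = polyWindowHeuristic g x y₁ y₂ = x · ∑_{y₁ < e ≤ y₂} ρ_g(e)/e`.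

For moduli `e > x` ("located" moduli) the inner count over `n ≤ x < e` sees each root class
`ν (mod e)` at most once, so `W_g(x; E, E']` counts the points `(e, ν)`, `E < e ≤ E'`,
`g(ν) ≡ 0 (mod e)` (`rootPoints g E E'`), whose angle `ν/e ∈ [0, 1)` lies in `[1/e, x/e]`.
Applying the ERDŐS–TURÁN inequality (`Literature.Analysis.Fourier.TrigApprox.erdosTuran_closed`,
transported here to finset-indexed families as `erdosTuran_finset`) to the whole block of points
with moduli in `(E, E']` — absolute values OUTSIDE the sum over moduli — the exponential sums that
appear are exactly the summed Hooley sums `∑_{E < e ≤ E'} S_g(d; e)` of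
`SoloInformedRootPairCorrelation`.  Result (`abs_polyWindowRootCount_sub_heuristic_le_erdosTuran`):
for `2 ≤ x ≤ E ≤ E' ≤ 2E`, `H ≥ 1`, `N = ∑_{E < e ≤ E'} ρ_g(e)`,

`|W_g(x; E, E'] − Heur_g(x; E, E']| ≤ (x/E − x/E' + 1/E) N + 802 N / H`
`    + (2/π + 1600) ∑_{d ≤ H} |∑_{E < e ≤ E'} S_g(d; e)| / d`.

The companion file `SoloInformedWindowEquidistribution` feeds Hooley's theorem (1964) into the
right-hand side and sums the blocks over a bounded window `(x, T x]`.
Also filed: `eAdd_natMul_eq_e`, `polyWindowRootCount_self`, `polyWindowRootCount_add` [folklore].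
-/

noncomputable section

open Finset Polynomial
open Literature.NumberTheory.Sieve (polyRootCountMod)
open Literature.Analysis.Fourier

namespace Summit.Parity.BatemanHorn.Theorems

/-! ## Erdős–Turán for a finset-indexed family -/

/-- **Erdős–Turán inequality, finset-indexed form.** [folklore]  For a family of reals `θ i`,
`i ∈ s`, and `0 ≤ a ≤ b ≤ 1`, `H ≥ 1`:
`|#{i ∈ s : a ≤ {θ i} ≤ b} − (b − a) #s|`
`  ≤ 802 #s / H + (2/π + 1600) ∑_{d ≤ H} |∑_{i ∈ s} e(d θ i)| / d`.
Transport of `TrigApprox.erdosTuran_closed` along `s ≃ Fin #s`. -/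
theorem erdosTuran_finset {α : Type*} (s : Finset α) (θ : α → ℝ) {a b : ℝ} (ha : 0 ≤ a)
    (hab : a ≤ b) (hb : b ≤ 1) {H : ℕ} (hH : 1 ≤ H) :
    |(#(s.filter fun i => a ≤ Int.fract (θ i) ∧ Int.fract (θ i) ≤ b) : ℝ) - (b - a) * #s|
      ≤ 802 * #s / H
        + (2 / Real.pi + 1600) * ∑ d ∈ Icc 1 H, ‖∑ i ∈ s, TrigApprox.e ((d : ℝ) * θ i)‖ / d := by
  classical
  set ω : Fin #s → ℝ := fun n => θ (s.equivFin.symm n : α) with hω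
  have key := TrigApprox.erdosTuran_closed ω ha hab hb hH
  have hcard : #(univ.filter fun n : Fin #s => a ≤ Int.fract (ω n) ∧ Int.fract (ω n) ≤ b)
      = #(s.filter fun i => a ≤ Int.fract (θ i) ∧ Int.fract (θ i) ≤ b) := by
    rw [card_filter, card_filter,
      ← sum_coe_sort s (fun i => if a ≤ Int.fract (θ i) ∧ Int.fract (θ i) ≤ b then 1 else 0)]
    exact Equiv.sum_comp s.equivFin.symm
      (fun i : s => if a ≤ Int.fract (θ (i : α)) ∧ Int.fract (θ (i : α)) ≤ b then 1 else 0)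
  have hsum : ∀ d : ℕ, TrigApprox.expSum ω d = ∑ i ∈ s, TrigApprox.e ((d : ℝ) * θ i) := by
    intro d
    unfold TrigApprox.expSum
    rw [← sum_coe_sort s (fun i => TrigApprox.e ((d : ℝ) * θ i))]
    simpa [hω] using
      Equiv.sum_comp s.equivFin.symm (fun i : s => TrigApprox.e ((d : ℝ) * θ (i : α)))
  rw [hcard] at key
  simpa only [hsum] using key

/-- `eAdd q (d ν) = e(d · ν/q)`: the tree's additive character versus the Literature `e`.
[folklore] -/
theorem eAdd_natMul_eq_e (q ν d : ℕ) :
    eAdd q ((d : ℤ) * ν) = TrigApprox.e ((d : ℝ) * ((ν : ℝ) / q)) := by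
  unfold eAdd TrigApprox.e
  congr 1
  push_cast
  ring

/-! ## Windows: additivity -/

/-- The empty window: `W_g(x; y, y) = 0`. [folklore] -/
theorem polyWindowRootCount_self (g : ℤ[X]) (x y : ℕ) : polyWindowRootCount g x y y = 0 := by
  unfold polyWindowRootCount
  refine sum_eq_zero fun n _ => ?_
  rw [card_eq_zero, filter_eq_empty_iff]
  intro e _ h
  omega

/-- Windows add: `W_g(x; y₁, y₃) = W_g(x; y₁, y₂) + W_g(x; y₂, y₃)` for `y₁ ≤ y₂ ≤ y₃`.
[folklore] -/
theorem polyWindowRootCount_add (g : ℤ[X]) (x : ℕ) {y₁ y₂ y₃ : ℕ} (h₁₂ : y₁ ≤ y₂)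
    (h₂₃ : y₂ ≤ y₃) :
    polyWindowRootCount g x y₁ y₃
      = polyWindowRootCount g x y₁ y₂ + polyWindowRootCount g x y₂ y₃ := by
  unfold polyWindowRootCount
  rw [← sum_add_distrib]
  refine sum_congr rfl fun n _ => ?_
  rw [← card_union_of_disjoint (disjoint_filter.2 fun e _ h₁ h₂ => by omega)]
  congr 1
  ext e
  simp only [mem_filter, mem_union, ← and_or_left]
  refine and_congr_right fun _ => ?_
  omega

/-! ## The block lemma: Erdős–Turán on one block of located moduli -/

/-- **Block lemma.** [this work]  For `2 ≤ x ≤ E ≤ E' ≤ 2E` and `H ≥ 1`, with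
`N = ∑_{E < e ≤ E'} ρ_g(e)`:
`|W_g(x; E, E'] − Heur_g(x; E, E']| ≤ (x/E − x/E' + 1/E) N + 802 N/H`
`+ (2/π + 1600) ∑_{d ≤ H} |∑_{E < e ≤ E'} S_g(d; e)| / d`.
Proof: the located points `(e, ν)` have angles `ν/e ∈ [0, 1)`; `{1 ≤ ν ≤ x}` is squeezed between
the arc conditions `1/E ≤ ν/e ≤ x/E'` and `0 ≤ ν/e ≤ x/E`, each counted by Erdős–Turán, whose
exponential sums are the summed Hooley sums; `Heur ∈ [(x/E') N, (x/E) N]`. -/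
theorem abs_polyWindowRootCount_sub_heuristic_le_erdosTuran (g : ℤ[X]) {x E E' H : ℕ}
    (hg0 : ∀ n ∈ Icc 1 x, g.eval (n : ℤ) ≠ 0) (hx : 2 ≤ x) (hxE : x ≤ E) (hEE' : E ≤ E')
    (hE'2 : E' ≤ 2 * E) (hH : 1 ≤ H) :
    |(polyWindowRootCount g x E E' : ℝ) - polyWindowHeuristic g x E E'|
      ≤ ((x : ℝ) / E - x / E' + 1 / E) * ∑ e ∈ Ioc E E', (polyRootCountMod ![g] e : ℝ)
        + (802 * (∑ e ∈ Ioc E E', (polyRootCountMod ![g] e : ℝ)) / H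
          + (2 / Real.pi + 1600)
            * ∑ d ∈ Icc 1 H, ‖∑ e ∈ Ioc E E', hooleySum g e d‖ / d) := by
  classical
  have hx0 : 0 < x := by omega
  have hE0 : 0 < E := lt_of_lt_of_le hx0 hxE
  have hE'0 : 0 < E' := lt_of_lt_of_le hE0 hEE'
  have hxr : (0 : ℝ) < x := by exact_mod_cast hx0
  have hEr : (0 : ℝ) < E := by exact_mod_cast hE0
  have hE'r : (0 : ℝ) < E' := by exact_mod_cast hE'0
  -- the located points: moduli in `(E, E']`, residues below the modulus
  have hpt : ∀ p ∈ rootPoints g E E', E < p.1 ∧ p.1 ≤ E' ∧ p.2 < p.1 := fun p hp => by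
    simp only [rootPoints, mem_sigma, mem_Ioc] at hp
    exact ⟨hp.1.1, hp.1.2, rootResidues_lt g p.1 p.2 hp.2⟩
  have hp1 : ∀ p ∈ rootPoints g E E', (0 : ℝ) < p.1 := fun p hp => by
    exact_mod_cast lt_of_le_of_lt (Nat.zero_le _) (hpt p hp).1
  have hfr : ∀ p ∈ rootPoints g E E', Int.fract ((p.2 : ℝ) / p.1) = (p.2 : ℝ) / p.1 :=
    fun p hp => Int.fract_eq_self.2 ⟨div_nonneg (Nat.cast_nonneg _) (hp1 p hp).le,
      (div_lt_one (hp1 p hp)).2 (by exact_mod_cast (hpt p hp).2.2)⟩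
  have hcardP : (#(rootPoints g E E') : ℝ) = ∑ e ∈ Ioc E E', (polyRootCountMod ![g] e : ℝ) := by
    rw [card_rootPoints, Nat.cast_sum]
  have hS0 : (0 : ℝ) ≤ ∑ e ∈ Ioc E E', (polyRootCountMod ![g] e : ℝ) :=
    sum_nonneg fun e _ => Nat.cast_nonneg _
  -- exponential sums over the points are the summed Hooley sums
  have hexp : ∀ d : ℕ, ∑ p ∈ rootPoints g E E', TrigApprox.e ((d : ℝ) * ((p.2 : ℝ) / p.1))
      = ∑ e ∈ Ioc E E', hooleySum g e d := fun d => by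
    rw [sum_Ioc_hooleySum_eq_sum_rootPoints]
    exact sum_congr rfl fun p _ => (eAdd_natMul_eq_e p.1 p.2 d).symm
  -- `W` as a count of located points with residue in `[1, x]`
  have hW : (polyWindowRootCount g x E E' : ℝ)
      = #((rootPoints g E E').filter fun p => 1 ≤ p.2 ∧ p.2 ≤ x) := by
    rw [polyWindowRootCount_eq_sum_card_rootResidues g hg0 hxE E']
    norm_cast
    rw [card_filter, rootPoints, sum_sigma]
    refine sum_congr rfl fun e _ => ?_
    rw [← filter_mem_eq_inter, card_filter]
    simp only [mem_Icc]
  -- `Heur` is squeezed between `(x/E') N` and `(x/E) N`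
  have hHeur_le : polyWindowHeuristic g x E E'
      ≤ (x : ℝ) / E * ∑ e ∈ Ioc E E', (polyRootCountMod ![g] e : ℝ) := by
    rw [polyWindowHeuristic_eq_sum, mul_sum]
    refine sum_le_sum fun e he => ?_
    have hEe : (E : ℝ) ≤ e := by exact_mod_cast (mem_Ioc.1 he).1.le
    rw [mul_div_assoc, div_mul_eq_mul_div, mul_div_assoc]
    exact mul_le_mul_of_nonneg_left
      (div_le_div_of_nonneg_left (Nat.cast_nonneg _) hEr hEe) hxr.le
  have hHeur_ge : (x : ℝ) / E' * ∑ e ∈ Ioc E E', (polyRootCountMod ![g] e : ℝ)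
      ≤ polyWindowHeuristic g x E E' := by
    rw [polyWindowHeuristic_eq_sum, mul_sum]
    refine sum_le_sum fun e he => ?_
    have heE' : (e : ℝ) ≤ E' := by exact_mod_cast (mem_Ioc.1 he).2
    have he0 : (0 : ℝ) < e := by
      exact_mod_cast lt_of_le_of_lt (Nat.zero_le _) (mem_Ioc.1 he).1
    rw [mul_div_assoc, div_mul_eq_mul_div, mul_div_assoc]
    exact mul_le_mul_of_nonneg_left
      (div_le_div_of_nonneg_left (Nat.cast_nonneg _) he0 heE') hxr.le
  -- upper count: residues in `[1, x]` have angle in `[0, x/E]`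
  have hxE1 : (x : ℝ) / E ≤ 1 := (div_le_one hEr).2 (by exact_mod_cast hxE)
  have hWup : (polyWindowRootCount g x E E' : ℝ)
      ≤ #((rootPoints g E E').filter fun p =>
          0 ≤ Int.fract ((p.2 : ℝ) / p.1) ∧ Int.fract ((p.2 : ℝ) / p.1) ≤ x / E) := by
    rw [hW, Nat.cast_le]
    refine card_le_card fun p hp => ?_
    rw [mem_filter] at hp ⊢
    obtain ⟨hpP, -, h2⟩ := hp
    refine ⟨hpP, ?_, ?_⟩
    · rw [hfr p hpP]; exact div_nonneg (Nat.cast_nonneg _) (hp1 p hpP).le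
    · rw [hfr p hpP]
      have h2' : (p.2 : ℝ) ≤ x := by exact_mod_cast h2
      have hE1 : (E : ℝ) ≤ p.1 := by exact_mod_cast (hpt p hpP).1.le
      calc (p.2 : ℝ) / p.1 ≤ x / p.1 := div_le_div_of_nonneg_right h2' (hp1 p hpP).le
        _ ≤ x / E := div_le_div_of_nonneg_left hxr.le hEr hE1
  have hETup := erdosTuran_finset (rootPoints g E E') (fun p => (p.2 : ℝ) / p.1) le_rfl
    (div_nonneg hxr.le hEr.le) hxE1 hH
  simp only [hexp, hcardP, sub_zero] at hETup
  -- lower count: angle in `[1/E, x/E']` forces residue in `[1, x]`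
  have hab : (1 : ℝ) / E ≤ x / E' := by
    rw [div_le_div_iff₀ hEr hE'r, one_mul]
    have : E' ≤ x * E := hE'2.trans (Nat.mul_le_mul_right _ hx)
    exact_mod_cast this
  have hxE'1 : (x : ℝ) / E' ≤ 1 := (div_le_one hE'r).2 (by exact_mod_cast hxE.trans hEE')
  have hWlo : (#((rootPoints g E E').filter fun p =>
        1 / (E : ℝ) ≤ Int.fract ((p.2 : ℝ) / p.1) ∧ Int.fract ((p.2 : ℝ) / p.1) ≤ x / E') : ℝ)
      ≤ polyWindowRootCount g x E E' := by
    rw [hW, Nat.cast_le]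
    refine card_le_card fun p hp => ?_
    rw [mem_filter] at hp ⊢
    obtain ⟨hpP, h1, h2⟩ := hp
    rw [hfr p hpP] at h1 h2
    refine ⟨hpP, ?_, ?_⟩
    · by_contra h0
      have hz : p.2 = 0 := by omega
      rw [hz, Nat.cast_zero, zero_div] at h1
      exact absurd h1 (not_le.2 (div_pos one_pos hEr))
    · have hE2 : (p.1 : ℝ) ≤ E' := by exact_mod_cast (hpt p hpP).2.1
      have h3 : (p.2 : ℝ) / p.1 ≤ x / p.1 :=
        h2.trans (div_le_div_of_nonneg_left hxr.le (hp1 p hpP) hE2)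
      have h4 : (p.2 : ℝ) ≤ x := (div_le_div_iff_of_pos_right (hp1 p hpP)).1 h3
      exact_mod_cast h4
  have hETlo := erdosTuran_finset (rootPoints g E E') (fun p => (p.2 : ℝ) / p.1)
    (div_nonneg zero_le_one hEr.le) hab hxE'1 hH
  simp only [hexp, hcardP] at hETlo
  -- combine
  have hpos : (0 : ℝ) ≤ 1 / E * ∑ e ∈ Ioc E E', (polyRootCountMod ![g] e : ℝ) :=
    mul_nonneg (div_nonneg zero_le_one hEr.le) hS0
  have hsplit1 :
      ((x : ℝ) / E - x / E' + 1 / E) * ∑ e ∈ Ioc E E', (polyRootCountMod ![g] e : ℝ)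
        = (x : ℝ) / E * ∑ e ∈ Ioc E E', (polyRootCountMod ![g] e : ℝ)
          - (x : ℝ) / E' * ∑ e ∈ Ioc E E', (polyRootCountMod ![g] e : ℝ)
          + 1 / E * ∑ e ∈ Ioc E E', (polyRootCountMod ![g] e : ℝ) := by ring
  have hsplit2 : ((x : ℝ) / E' - 1 / E) * ∑ e ∈ Ioc E E', (polyRootCountMod ![g] e : ℝ)
      = (x : ℝ) / E' * ∑ e ∈ Ioc E E', (polyRootCountMod ![g] e : ℝ)
        - 1 / E * ∑ e ∈ Ioc E E', (polyRootCountMod ![g] e : ℝ) := by ring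
  rw [abs_le] at hETup hETlo ⊢
  constructor
  · linarith [hETlo.1, hHeur_le, hWlo, hsplit1, hsplit2]
  · linarith [hETup.2, hHeur_ge, hWup, hsplit1, hpos]

end Summit.Parity.BatemanHorn.Theorems

end
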